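import Summits.CriticalPhenomena.SAWScalingLimit.Theorems.SAWRenewalTightnessTubeLowerBoundProfilePotentialDefs
import Summits.CriticalPhenomena.SAWScalingLimit.Theorems.SAWRenewalTightnessTubeLowerBoundQuarterFlux

/-!
# Crux `TubeLowerBound` (stmt-CriticalPhenomena-4730), line `profile-potential`: `stub_quadrantCut`

`stub_quadrantCut : QuadrantCut` — the fugacity-free Simon–Lieb / Hammersley first-exit cut run
INSIDE the quadrant `Q = {x ≥ 0, y ≥ 0}` of `ℤ²` from its corner `0`, with the closed square
`[0,R]²` as inner set, length by length:

  `q_n ≤ s_n + 2 Σ_{k ≤ n} e_k · q^{(R+1)}_{n−k}`,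

where `q_n = #quadWalks 0 n`, `s_n = #squareWalks R n`, `e_k = #cornerExitEast R k` and
`q^{(a)}_m = #quadWalks a m` (objects of `…TubeLowerBoundProfilePotentialDefs`).  PROVED outright
(no named facts, no hypotheses, no new definitions).

Proof.  For a corner walk `ω ∈ quadWalks 0 n` let `k = Nat.find (exists_exit R n ω)` be the first
time at which `ω` is outside `[0,R]²` or time `n` is up.  Either `ω` stays in the square up to
time `n` (`ω ∈ squareWalks R n`), or `1 ≤ k ≤ n`, `ω i ∈ [0,R]²` for `i < k`, and
`ω k ∈ Q ∖ [0,R]²` is a lattice neighbour of `ω (k−1) ∈ [0,R]²`; one step changes exactly one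
coordinate, by `±1` (`step_cases`), so `ω` exits EAST (`ω k = (R+1, y)`, `0 ≤ y ≤ R`) or NORTH
(`ω k = (x, R+1)`, `0 ≤ x ≤ R`): `exit_trichotomy`.  An east-exit walk is sent to
`(k, prefix, translated suffix)`, an element of
`Σ_{k ≤ n} cornerExitEast R k × quadWalks (R+1) (n−k)` (`LiebSimon.prefix_mem_saws`,
`LiebSimon.suffix_mem_saws`), injectively (a walk is recovered from
its two halves, `eq_of_parts_eq`, as in `LiebSimon.count_le_cut`); a north-exit walk likewise with
the TRANSPOSED prefix (the diagonal mirror `transposeIso` fixes `0` and is an automorphism of the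
square lattice, so the transposed prefix is an east first-exit prefix).  Counting the three classes
(`Finset.card_le_card_of_injOn`, `Finset.card_sigma`, `Finset.card_product`) gives the inequality.

Sources: B. Simon, Comm. Math. Phys. 77 (1980) 111–126; E. H. Lieb, Comm. Math. Phys. 77 (1980)
127–135; N. Madras, G. Slade, *The Self-Avoiding Walk* (Birkhäuser 1993), §1.2, §1.5 and
Lemma A.1 (the first-exit / Hammersley–Welsh cut, here run inside a domain with boundary).
-/

noncomputable section

namespace Summit.CriticalPhenomena.SAWScalingLimit.Theorems.TubeLowerBound.ProfilePotential

open scoped BigOperators Classical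
open Literature.Probability.LatticeModels
open Literature.Probability.RandomPlanarGeometry Literature.Probability.RandomPlanarGeometry.SAW
open Literature.Probability.Percolation (transposeIso transposeIso_apply_zero
  transposeIso_apply_one)
open Summit.CriticalPhenomena.SAWScalingLimit.Theorems.TubeLowerBound.LiebSimonStar

namespace QuadrantCutProof

/-! ### One lattice step; the cut time -/

/-- One step of the square lattice changes exactly one coordinate, by `±1`. -/
theorem step_cases {x y : Site 2} (h : (zdGraph 2).Adj x y) :
    (y 1 = x 1 ∧ (y 0 = x 0 + 1 ∨ x 0 = y 0 + 1)) ∨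
      (y 0 = x 0 ∧ (y 1 = x 1 + 1 ∨ x 1 = y 1 + 1)) := by
  obtain ⟨i, hi | hi⟩ := (zdGraph_adj_iff x y).1 h
  · have h0 := congrFun hi 0
    have h1 := congrFun hi 1
    fin_cases i <;> simp at h0 h1 <;> omega
  · have h0 := congrFun hi 0
    have h1 := congrFun hi 1
    fin_cases i <;> simp at h0 h1 <;> omega

/-- There is a time at which the walk is outside `[0,R]²` or time `n` is up (namely `n`); the
cut time of `ω` is the first such time `Nat.find (exists_exit R n ω)`. -/
theorem exists_exit (R n : ℕ) (ω : ℕ → Site 2) :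
    ∃ i, ¬(0 ≤ ω i 0 ∧ ω i 0 ≤ (R : ℤ) ∧ 0 ≤ ω i 1 ∧ ω i 1 ≤ (R : ℤ)) ∨ n ≤ i :=
  ⟨n, Or.inr le_rfl⟩

/-- The cut time is at most `n`. -/
theorem find_le (R n : ℕ) (ω : ℕ → Site 2) : Nat.find (exists_exit R n ω) ≤ n :=
  Nat.find_min' _ (Or.inr le_rfl)

/-- Before the cut time the walk is inside the square. -/
theorem inSq_of_lt_find {R n : ℕ} {ω : ℕ → Site 2} {i : ℕ}
    (hi : i < Nat.find (exists_exit R n ω)) :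
    0 ≤ ω i 0 ∧ ω i 0 ≤ (R : ℤ) ∧ 0 ≤ ω i 1 ∧ ω i 1 ≤ (R : ℤ) := by
  have h := Nat.find_min (exists_exit R n ω) hi
  by_contra hc
  exact h (Or.inl hc)

/-- **Exit trichotomy.** A corner walk of the quadrant stays in `[0,R]²` up to time `n`, or at its
cut time `k` it sits at `(R+1, y)` with `0 ≤ y ≤ R` (east exit) or at `(x, R+1)` with `0 ≤ x ≤ R`
(north exit): `ω (k−1) ∈ [0,R]²` is a lattice neighbour of `ω k ∈ Q ∖ [0,R]²`, and one step
changes one coordinate by `±1`. -/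
theorem exit_trichotomy {R n : ℕ} {ω : ℕ → Site 2} (hω : ω ∈ quadWalks 0 n) :
    ω ∈ squareWalks R n ∨
      (ω (Nat.find (exists_exit R n ω)) 0 = (R : ℤ) + 1 ∧ 0 ≤ ω (Nat.find (exists_exit R n ω)) 1 ∧
          ω (Nat.find (exists_exit R n ω)) 1 ≤ (R : ℤ)) ∨
        (ω (Nat.find (exists_exit R n ω)) 1 = (R : ℤ) + 1 ∧
          0 ≤ ω (Nat.find (exists_exit R n ω)) 0 ∧
            ω (Nat.find (exists_exit R n ω)) 0 ≤ (R : ℤ)) := by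
  rw [quadWalks, Finset.mem_filter] at hω
  obtain ⟨hsaw, hquad⟩ := hω
  obtain ⟨h0, -, hadj, -⟩ := Zd.mem_saws.1 hsaw
  have h00 : ω 0 0 = 0 := by simp [h0]
  have h01 : ω 0 1 = 0 := by simp [h0]
  have hkn := find_le R n ω
  have hbefore : ∀ i < Nat.find (exists_exit R n ω),
      0 ≤ ω i 0 ∧ ω i 0 ≤ (R : ℤ) ∧ 0 ≤ ω i 1 ∧ ω i 1 ≤ (R : ℤ) := fun i hi =>
    inSq_of_lt_find hi
  have hspec := Nat.find_spec (exists_exit R n ω)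
  generalize Nat.find (exists_exit R n ω) = k at hkn hbefore hspec ⊢
  by_cases hsq : 0 ≤ ω k 0 ∧ ω k 0 ≤ (R : ℤ) ∧ 0 ≤ ω k 1 ∧ ω k 1 ≤ (R : ℤ)
  · -- no exit: `k = n` and the walk stays in the square up to time `n`
    have hk : k = n := le_antisymm hkn (hspec.resolve_left fun h => h hsq)
    refine Or.inl (Finset.mem_filter.2 ⟨hsaw, fun i hi => ?_⟩)
    rcases hi.lt_or_eq with hi' | hi'
    · exact hbefore i (by omega)
    · rw [hi', ← hk]
      exact hsq
  · -- exit at a time `k ≥ 1`, from `ω (k-1) ∈ [0,R]²`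
    right
    have hk1 : 1 ≤ k := by
      rcases Nat.eq_zero_or_pos k with hk | hk
      · subst hk
        omega
      · exact hk
    have hprev := hbefore (k - 1) (by omega)
    have hstep := hadj (k - 1) (by omega)
    rw [Nat.sub_add_cancel hk1] at hstep
    have hq := hquad k hkn
    simp only [Nat.cast_zero, neg_zero] at hq
    rcases step_cases hstep with ⟨h1, h2 | h2⟩ | ⟨h1, h2 | h2⟩ <;> omega

/-! ### Prefix, translated suffix, reconstruction -/

/-- An `n`-step self-avoiding walk is determined by its first `k ≤ n` vertices and its translated
remainder `j ↦ ω (k + min j (n−k)) − ω k` (it is frozen beyond time `n`). -/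
theorem eq_of_parts_eq {n k : ℕ} {ω ω' : ℕ → Site 2} (hkn : k ≤ n) (hω : ω ∈ Zd.saws 2 n)
    (hω' : ω' ∈ Zd.saws 2 n) (hπ : ∀ i ≤ k, ω i = ω' i)
    (hυ : (fun j => ω (k + min j (n - k)) - ω k) = fun j => ω' (k + min j (n - k)) - ω' k) :
    ω = ω' := by
  -- adapted from `LiebSimon.count_le_cut` (…TubeLowerBoundQuarterFlux.lean)
  have hfro := (Zd.mem_saws.1 hω).2.1
  have hfro' := (Zd.mem_saws.1 hω').2.1
  have hkk : ω k = ω' k := hπ k le_rfl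
  funext i
  rcases le_or_gt i k with hi | hi
  · exact hπ i hi
  · obtain ⟨j, rfl⟩ : ∃ j, i = k + j := ⟨i - k, by omega⟩
    rcases le_or_gt j (n - k) with hj | hj
    · have := congrFun hυ j
      simp only [min_eq_left hj] at this
      rwa [hkk, sub_left_inj] at this
    · have := congrFun hυ (n - k)
      simp only [min_self] at this
      rw [hkk, sub_left_inj, Nat.add_sub_of_le hkn] at this
      rw [hfro (k + j) (by omega), hfro' (k + j) (by omega), this]

/-- The prefix `i ↦ ω (min i k)` of an east-exit walk is an east first-exit prefix of the square. -/
theorem prefix_mem_cornerExitEast {R n k : ℕ} {ω : ℕ → Site 2} (hsaw : ω ∈ Zd.saws 2 n)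
    (hkn : k ≤ n) (hbefore : ∀ i < k, 0 ≤ ω i 0 ∧ ω i 0 ≤ (R : ℤ) ∧ 0 ≤ ω i 1 ∧ ω i 1 ≤ (R : ℤ))
    (hat : ω k 0 = (R : ℤ) + 1 ∧ 0 ≤ ω k 1 ∧ ω k 1 ≤ (R : ℤ)) :
    (fun i => ω (min i k)) ∈ cornerExitEast R k := by
  rw [cornerExitEast, Finset.mem_filter]
  refine ⟨LiebSimon.prefix_mem_saws hkn hsaw, fun i hi => ?_, ?_⟩
  · simp only [min_eq_left hi.le]
    exact hbefore i hi
  · simp only [min_self]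
    exact hat

/-- The transposed prefix `i ↦ (ω (min i k))ᵀ` of a north-exit walk is an east first-exit prefix
of the square (the diagonal mirror `transposeIso` fixes `0` and is a lattice automorphism). -/
theorem transpose_prefix_mem_cornerExitEast {R n k : ℕ} {ω : ℕ → Site 2}
    (hsaw : ω ∈ Zd.saws 2 n) (hkn : k ≤ n)
    (hbefore : ∀ i < k, 0 ≤ ω i 0 ∧ ω i 0 ≤ (R : ℤ) ∧ 0 ≤ ω i 1 ∧ ω i 1 ≤ (R : ℤ))
    (hat : ω k 1 = (R : ℤ) + 1 ∧ 0 ≤ ω k 0 ∧ ω k 0 ≤ (R : ℤ)) :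
    (fun i => transposeIso (ω (min i k))) ∈ cornerExitEast R k := by
  -- adapted from `LiebSimon.card_filter_le_east` (…TubeLowerBoundQuarterFlux.lean)
  rw [cornerExitEast, Finset.mem_filter]
  obtain ⟨h0, hend, hadj, hinj⟩ := Zd.mem_saws.1 (LiebSimon.prefix_mem_saws hkn hsaw)
  refine ⟨Zd.mem_saws.2 ⟨?_, fun i hi => ?_, fun i hi => transposeIso.map_adj_iff.2 (hadj i hi),
    fun i hi j hj hij => hinj hi hj (transposeIso.injective hij)⟩, fun i hi => ?_, ?_⟩
  · show transposeIso (ω (min 0 k)) = 0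
    rw [show ω (min 0 k) = 0 from h0]
    funext i
    fin_cases i <;> simp
  · show transposeIso (ω (min i k)) = transposeIso (ω (min k k))
    exact congrArg _ (hend i hi)
  · simp only [transposeIso_apply_zero, transposeIso_apply_one, min_eq_left hi.le]
    have h := hbefore i hi
    exact ⟨h.2.2.1, h.2.2.2, h.1, h.2.1⟩
  · simp only [transposeIso_apply_zero, transposeIso_apply_one, min_self]
    exact hat

/-- The translated suffix of a corner walk of the quadrant cut at a point of `[0,R+1]²` stays in
the shifted quadrant `{x ≥ −(R+1), y ≥ −(R+1)}`. -/
theorem suffix_mem_quadWalks {R n k : ℕ} {ω : ℕ → Site 2} (hω : ω ∈ quadWalks 0 n)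
    (hkn : k ≤ n) (hk0 : ω k 0 ≤ (R : ℤ) + 1) (hk1 : ω k 1 ≤ (R : ℤ) + 1) :
    (fun j => ω (k + min j (n - k)) - ω k) ∈ quadWalks (R + 1) (n - k) := by
  rw [quadWalks, Finset.mem_filter] at hω ⊢
  obtain ⟨hsaw, hquad⟩ := hω
  refine ⟨LiebSimon.suffix_mem_saws hkn hsaw, fun j hj => ?_⟩
  have hq := hquad (k + j) (by omega)
  simp only [Nat.cast_zero, neg_zero] at hq
  simp only [min_eq_left hj, Pi.sub_apply, Nat.cast_add, Nat.cast_one]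
  omega

/-! ### Counting the three classes -/

/-- `#(Σ_{k ≤ n} cornerExitEast R k × quadWalks (R+1) (n−k)) = Σ_{k ≤ n} e_k · q^{(R+1)}_{n−k}`. -/
theorem card_target (R n : ℕ) :
    ((Finset.range (n + 1)).sigma fun k => cornerExitEast R k ×ˢ quadWalks (R + 1) (n - k)).card =
      ∑ k ∈ Finset.range (n + 1), (cornerExitEast R k).card * (quadWalks (R + 1) (n - k)).card := by
  rw [Finset.card_sigma]
  exact Finset.sum_congr rfl fun k _ => Finset.card_product _ _

/-- **East class.** The corner walks sitting on the column `x = R+1` at their cut time `k` are at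
most `Σ_{k ≤ n} e_k · q^{(R+1)}_{n−k}`: `ω ↦ (k, prefix, translated suffix)` is an injection into
`Σ_{k ≤ n} cornerExitEast R k × quadWalks (R+1) (n−k)`. -/
theorem card_east_le (R n : ℕ) :
    ((quadWalks 0 n).filter fun ω => ω (Nat.find (exists_exit R n ω)) 0 = (R : ℤ) + 1).card ≤
      ∑ k ∈ Finset.range (n + 1), (cornerExitEast R k).card * (quadWalks (R + 1) (n - k)).card := by
  rw [← card_target]
  refine Finset.card_le_card_of_injOn
    (fun ω => (⟨Nat.find (exists_exit R n ω), (fun i => ω (min i (Nat.find (exists_exit R n ω))),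
      fun j => ω (Nat.find (exists_exit R n ω) + min j (n - Nat.find (exists_exit R n ω))) -
        ω (Nat.find (exists_exit R n ω)))⟩ : Σ _ : ℕ, (ℕ → Site 2) × (ℕ → Site 2)))
    (fun ω hω => ?_) (fun ω hω ω' hω' h => ?_)
  · rw [Finset.mem_coe, Finset.mem_filter] at hω
    obtain ⟨hω, hE⟩ := hω
    have hsaw : ω ∈ Zd.saws 2 n := (Finset.mem_filter.1 hω).1
    have hkn := find_le R n ω
    have hbefore : ∀ i < Nat.find (exists_exit R n ω),
        0 ≤ ω i 0 ∧ ω i 0 ≤ (R : ℤ) ∧ 0 ≤ ω i 1 ∧ ω i 1 ≤ (R : ℤ) := fun i hi =>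
      inSq_of_lt_find hi
    have htri := exit_trichotomy (R := R) hω
    simp only [Finset.mem_coe, Finset.mem_sigma, Finset.mem_range, Finset.mem_product]
    generalize Nat.find (exists_exit R n ω) = k at hE hkn hbefore htri ⊢
    have hat : ω k 0 = (R : ℤ) + 1 ∧ 0 ≤ ω k 1 ∧ ω k 1 ≤ (R : ℤ) := by
      rcases htri with h | h | h
      · rw [squareWalks, Finset.mem_filter] at h
        have := h.2 k hkn
        omega
      · exact h
      · omega
    exact ⟨Nat.lt_succ_of_le hkn, prefix_mem_cornerExitEast hsaw hkn hbefore hat,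
      suffix_mem_quadWalks hω hkn hat.1.le (by omega)⟩
  · rw [Finset.mem_coe, Finset.mem_filter] at hω hω'
    have hsaw : ω ∈ Zd.saws 2 n := (Finset.mem_filter.1 hω.1).1
    have hsaw' : ω' ∈ Zd.saws 2 n := (Finset.mem_filter.1 hω'.1).1
    have hkn := find_le R n ω
    simp only [Sigma.mk.injEq, heq_eq_eq, Prod.mk.injEq] at h
    obtain ⟨hk, hπ, hυ⟩ := h
    rw [← hk] at hπ hυ
    generalize Nat.find (exists_exit R n ω) = k at hkn hπ hυ
    exact eq_of_parts_eq hkn hsaw hsaw'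
      (fun i hi => by simpa [min_eq_left hi] using congrFun hπ i) hυ

/-- **North class.** The corner walks sitting on the row `y = R+1` at their cut time `k` are at
most `Σ_{k ≤ n} e_k · q^{(R+1)}_{n−k}`: `ω ↦ (k, transposed prefix, translated suffix)` is an
injection into `Σ_{k ≤ n} cornerExitEast R k × quadWalks (R+1) (n−k)`. -/
theorem card_north_le (R n : ℕ) :
    ((quadWalks 0 n).filter fun ω => ω (Nat.find (exists_exit R n ω)) 1 = (R : ℤ) + 1).card ≤
      ∑ k ∈ Finset.range (n + 1), (cornerExitEast R k).card * (quadWalks (R + 1) (n - k)).card := by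
  rw [← card_target]
  refine Finset.card_le_card_of_injOn
    (fun ω => (⟨Nat.find (exists_exit R n ω),
      (fun i => transposeIso (ω (min i (Nat.find (exists_exit R n ω)))),
      fun j => ω (Nat.find (exists_exit R n ω) + min j (n - Nat.find (exists_exit R n ω))) -
        ω (Nat.find (exists_exit R n ω)))⟩ : Σ _ : ℕ, (ℕ → Site 2) × (ℕ → Site 2)))
    (fun ω hω => ?_) (fun ω hω ω' hω' h => ?_)
  · rw [Finset.mem_coe, Finset.mem_filter] at hω
    obtain ⟨hω, hN⟩ := hω
    have hsaw : ω ∈ Zd.saws 2 n := (Finset.mem_filter.1 hω).1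
    have hkn := find_le R n ω
    have hbefore : ∀ i < Nat.find (exists_exit R n ω),
        0 ≤ ω i 0 ∧ ω i 0 ≤ (R : ℤ) ∧ 0 ≤ ω i 1 ∧ ω i 1 ≤ (R : ℤ) := fun i hi =>
      inSq_of_lt_find hi
    have htri := exit_trichotomy (R := R) hω
    simp only [Finset.mem_coe, Finset.mem_sigma, Finset.mem_range, Finset.mem_product]
    generalize Nat.find (exists_exit R n ω) = k at hN hkn hbefore htri ⊢
    have hat : ω k 1 = (R : ℤ) + 1 ∧ 0 ≤ ω k 0 ∧ ω k 0 ≤ (R : ℤ) := by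
      rcases htri with h | h | h
      · rw [squareWalks, Finset.mem_filter] at h
        have := h.2 k hkn
        omega
      · omega
      · exact h
    exact ⟨Nat.lt_succ_of_le hkn, transpose_prefix_mem_cornerExitEast hsaw hkn hbefore hat,
      suffix_mem_quadWalks hω hkn (by omega) hat.1.le⟩
  · rw [Finset.mem_coe, Finset.mem_filter] at hω hω'
    have hsaw : ω ∈ Zd.saws 2 n := (Finset.mem_filter.1 hω.1).1
    have hsaw' : ω' ∈ Zd.saws 2 n := (Finset.mem_filter.1 hω'.1).1
    have hkn := find_le R n ω
    simp only [Sigma.mk.injEq, heq_eq_eq, Prod.mk.injEq] at h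
    obtain ⟨hk, hπ, hυ⟩ := h
    rw [← hk] at hπ hυ
    generalize Nat.find (exists_exit R n ω) = k at hkn hπ hυ
    exact eq_of_parts_eq hkn hsaw hsaw'
      (fun i hi => by simpa [min_eq_left hi] using transposeIso.injective (congrFun hπ i)) hυ

/-- **Cover.** Every corner walk stays in the square, or is in the east class, or is in the north
class (`exit_trichotomy`). -/
theorem card_quadWalks_le (R n : ℕ) : (quadWalks 0 n).card ≤ (squareWalks R n).card +
    ((quadWalks 0 n).filter fun ω => ω (Nat.find (exists_exit R n ω)) 0 = (R : ℤ) + 1).card +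
    ((quadWalks 0 n).filter fun ω => ω (Nat.find (exists_exit R n ω)) 1 = (R : ℤ) + 1).card := by
  set E := (quadWalks 0 n).filter fun ω => ω (Nat.find (exists_exit R n ω)) 0 = (R : ℤ) + 1
    with hEdef
  set N := (quadWalks 0 n).filter fun ω => ω (Nat.find (exists_exit R n ω)) 1 = (R : ℤ) + 1
    with hNdef
  calc (quadWalks 0 n).card ≤ (squareWalks R n ∪ (E ∪ N)).card := by
        refine Finset.card_le_card fun ω hω => ?_
        rcases exit_trichotomy (R := R) hω with h | h | h
        · exact Finset.mem_union_left _ h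
        · exact Finset.mem_union_right _
            (Finset.mem_union_left _ (hEdef ▸ Finset.mem_filter.2 ⟨hω, h.1⟩))
        · exact Finset.mem_union_right _
            (Finset.mem_union_right _ (hNdef ▸ Finset.mem_filter.2 ⟨hω, h.1⟩))
    _ ≤ (squareWalks R n).card + (E ∪ N).card := Finset.card_union_le _ _
    _ ≤ (squareWalks R n).card + (E.card + N.card) :=
        Nat.add_le_add_left (Finset.card_union_le _ _) _
    _ = _ := (Nat.add_assoc _ _ _).symm

end QuadrantCutProof

open QuadrantCutProof in
/-- **`QuadrantCut`** (registered stub `stub_quadrantCut` of the line `profile-potential`): for all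
`R n`, `q_n ≤ s_n + 2 Σ_{k ≤ n} e_k · q^{(R+1)}_{n−k}` — the first-exit cut of corner-started
self-avoiding walks of the quadrant at the closed square `[0,R]²`: a corner walk stays in the
square, or exits east (prefix in `cornerExitEast R k`, translated suffix in `quadWalks (R+1) (n−k)`)
or north (the diagonal mirror image of an east exit), and `ω ↦ (k, prefix, suffix)` is injective.
(Simon 1980; Lieb 1980; Madras–Slade 1993 §1.2, Lemma A.1 — the Hammersley–Welsh / Simon–Lieb cut
run inside a domain with boundary.) -/
theorem stub_quadrantCut : QuadrantCut := by
  intro R n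
  have h₁ := card_quadWalks_le R n
  have h₂ := card_east_le R n
  have h₃ := card_north_le R n
  have h : (quadWalks 0 n).card ≤ (squareWalks R n).card +
      2 * ∑ k ∈ Finset.range (n + 1),
        (cornerExitEast R k).card * (quadWalks (R + 1) (n - k)).card := by
    omega
  exact_mod_cast h

end Summit.CriticalPhenomena.SAWScalingLimit.Theorems.TubeLowerBound.ProfilePotential

end
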